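import Summits.QuantumFields.BalabanUV.T4Continuum.Support.B13TermHistSecant

/-!
# NE5 ∕ U3 — O2-hist, secant face: NON-VACUITY WITNESS for the activity-level producer
# `B13TermHistSecant.histSecant_b13_of_act` (a one-polymer Ursell family with activity `exp(o + h)` against a Dirac mass)

Cell `pub-balaban`, unit `b2b-balaban-t4-ne5-formalise-leaf-03` (NE5 formalisation swarm, LEAF PROVER 03, gen 2; companion of
`Support/B13TermHistSecant.lean`).  Summits-side bookkeeping under the LEAN PLACEMENT RULE.  A TOY — nothing of
[Balaban1988RG2Cluster] is modelled.  HONEST FRAMING: rung (B)+1 of the FINITE-VOLUME T⁴ programme — NOT infinite volume, NOT a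
mass gap, NOT the Clay problem, NOT NE5 (NOT PRINTED; GAPS G-t4-U3-1).  HONEST DEPENDENCY (cell line, verbatim): continuum YM on T⁴
⇐ BetaPertH ∧ nine spine estimates (0/9 proved); BetaPertH ⇐ (D1) ∧ (D4) ∧ CAP+tail; G-an2-4 gates asym, D1 and NE2/3/4.

WHAT IS SHOWN.  On the carriers `T4InputCauchyRate.toyCarriers`, the ONE-POLYMER indexing `oneIndexing` (one index, one factor,
localizing at every step-`k` domain), leaf-08's toy activity `B13StepTermFamily.toyAct` (`exp(o + h)`) and exhibited data `toyData`
(Dirac mass, weight `exp o`, functional `id`), the step model `toyModel` (`Out := out oneIndexing topInc toyAct`, unit margins) and the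
class `toyClass` (`‖o‖ ≤ 1`, `‖h‖ ≤ 1`): EVERY hypothesis of `histSecant_b13_of_act` holds with the explicit data `N ≡ 1`
(`‖id‖·rHist ≤ 1`), `A ≡ e²` (`∫ ‖e^{o}‖·‖e^{h}‖ dδ ≤ e·e`), `actMajorant ≡ e²`, `secMajorant ≡ e²`, `G₁ = e²` (`toy_histSecant` :
`HistSecant toyModel toyClass univ 0 (2e²)`), and the conclusion is the non-trivial secant `‖e^{o+h′} − e^{o+h}‖ ≤ 2e²·‖h′ − h‖` on
that class (`toy_reading`) — so the producer is not circular and its binder list is satisfiable.  0 sorry; axioms ⊆ {propext,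
Classical.choice, Quot.sound}.
-/

noncomputable section

open MeasureTheory Metric Set
open scoped BigOperators

namespace Summit.QuantumFields.BalabanUV.T4Continuum.B13TermHistSecantWitness

open Literature.MathematicalPhysics.QuantumFieldTheory.Balaban1983to89.T4OutputRate (Carriers)
open Literature.MathematicalPhysics.QuantumFieldTheory.Balaban1983to89.T4InputCauchyRate (toyCarriers)
open Literature.MathematicalPhysics.QuantumFieldTheory.Balaban1983to89.T4InputCauchyRateData (StepModel)
open Literature.MathematicalPhysics.QuantumFieldTheory.Balaban1983to89.T4InputCauchyRateSecant (HistSecant)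
open Summit.QuantumFields.BalabanUV.T4Continuum.B13StepTermFamily
  (TermIndexing ActData ActExpLinearOn coeff term out out_eq_tsum term_single rhoT_one toyAct toyData)
open Summit.QuantumFields.BalabanUV.T4Continuum.B13TermRep (actMajorant actMajorant_of_rel)
open Summit.QuantumFields.BalabanUV.T4Continuum.B13TermHistSecant
  (ActExpNormBound ActAbsBound secMajorant histSecant_b13_of_act)

/-- [folklore] The ONE-POLYMER indexing over the toy carriers: a single index, a single factor, localizing at every step-`k` domain. -/
def oneIndexing : TermIndexing toyCarriers Unit Unit Unit where
  len _ := 0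
  poly _ _ := ()
  lab _ _ := ()
  Rel k _ X := toyCarriers.scale X = k
  decRel _ _ _ := by infer_instance

/-- [folklore] All polymers incompatible (irrelevant for one factor: `ρᵀ(Z) = 1`). -/
abbrev topInc : Unit → Unit → Prop := fun _ _ => True

/-- [folklore] The toy step model: output = the one-polymer Ursell series of `exp(o + h)`; data maps and base are placeholders (the
secant face reads only `Out` and the history margin `rHist ≡ 1`). -/
def toyModel : StepModel toyCarriers ℂ ℂ where
  Out := out oneIndexing topInc toyAct
  opA _ _ _ := 0
  opB _ _ _ := 0
  insA _ _ _ _ := 0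
  insB _ _ _ _ := 0
  Base _ _ _ := Set.univ
  rOp _ := 1
  rHist _ := 1
  rOp_pos _ := one_pos
  rHist_pos _ := one_pos

/-- [folklore] The toy class: `‖o‖ ≤ 1`, `‖h‖ ≤ 1` at every step. -/
def toyClass : ℕ → (ℕ → ℝ) → toyCarriers.BgB → Set (ℂ × ℂ) := fun _ _ _ => closedBall 0 1 ×ˢ closedBall 0 1

/-- [folklore] Membership in the toy class, unfolded. -/
theorem mem_toyClass {k : ℕ} {g : ℕ → ℝ} {U : toyCarriers.BgB} {q : ℂ × ℂ} (hq : q ∈ toyClass k g U) :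
    ‖q.1‖ ≤ 1 ∧ ‖q.2‖ ≤ 1 := by
  obtain ⟨h1, h2⟩ := Set.mem_prod.1 hq
  exact ⟨mem_closedBall_zero_iff.1 h1, mem_closedBall_zero_iff.1 h2⟩

/-- [folklore] The coefficient of the single index is `1` (`1!⁻¹ · ρᵀ(Z₀) = 1`). -/
theorem coeff_one (i : Unit) : coeff oneIndexing topInc i = 1 := by
  show ((Nat.factorial (0 + 1) : ℂ))⁻¹ * (B13StepTermFamily.rhoT topInc (fun _ : Fin (0 + 1) => ()) : ℂ) = 1
  rw [rhoT_one]; simp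

/-- [folklore] The toy's single term IS the activity: `term k i o h X = exp(o + h)` at step-`k` domains. -/
theorem term_eq {k : ℕ} {X : toyCarriers.Dom} (hX : toyCarriers.scale X = k) (i : Unit) (o h : ℂ) :
    term oneIndexing topInc toyAct k i o h X = Complex.exp (o + h) := by
  rw [term_single oneIndexing topInc toyAct (i := i) hX rfl]; exact Fin.prod_univ_one _

/-- [folklore] … hence so is the output (a one-term series). -/
theorem out_eq {k : ℕ} {X : toyCarriers.Dom} (hX : toyCarriers.scale X = k) (o h : ℂ) :
    toyModel.Out k o h X = Complex.exp (o + h) := by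
  show out oneIndexing topInc toyAct k o h X = _
  rw [out_eq_tsum, tsum_fintype, Fintype.sum_unique, term_eq hX]

/-- [folklore] STRUCTURE: the toy activity is exp-linear on the toy class (as in leaf-08's `toy_actExpLinearOn`, for `oneIndexing`). -/
theorem toy_actExpLinearOn : ActExpLinearOn oneIndexing toyAct toyData toyClass Set.univ := by
  refine ⟨fun _ _ _ _ _ _ _ _ _ _ _ => ?_, fun _ _ _ _ q _ _ _ _ _ _ => ?_, fun _ _ _ _ _ _ _ _ _ _ _ _ => ?_,
    fun _ _ _ _ _ _ _ _ _ _ _ => ⟨1, ?_⟩, fun _ _ _ _ q _ _ _ _ _ _ => ?_⟩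
  · show SigmaFinite (Measure.dirac ()); infer_instance
  · show Integrable (fun _ : Unit => Complex.exp q.1) (Measure.dirac ()); exact integrable_const _
  · exact aestronglyMeasurable_const
  · exact Filter.Eventually.of_forall fun _ => by
      show ‖ContinuousLinearMap.id ℂ ℂ‖ ≤ 1
      exact ContinuousLinearMap.norm_id_le
  · show Complex.exp (q.1 + q.2) = ∫ _ : Unit, Complex.exp q.1 * Complex.exp (ContinuousLinearMap.id ℂ ℂ q.2)
      ∂(Measure.dirac ())
    rw [integral_dirac, ContinuousLinearMap.id_apply, Complex.exp_add]

/-- [folklore] EXPONENT BOUND: `‖id‖·rHist ≤ 1`, i.e. `ActExpNormBound … toyModel.rHist (N ≡ 1)`. -/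
theorem toy_normBound : ActExpNormBound oneIndexing toyData toyClass Set.univ toyModel.rHist fun _ _ _ _ _ => 1 :=
  fun _ _ _ _ _ _ _ _ _ _ _ => Filter.Eventually.of_forall fun _ => by
    show ‖ContinuousLinearMap.id ℂ ℂ‖ * 1 ≤ 1
    rw [mul_one]; exact ContinuousLinearMap.norm_id_le

/-- [folklore] ABSOLUTE MAJORANT: on the class `∫ ‖e^{o}‖·‖e^{id h}‖ dδ = e^{Re o}·e^{Re h} ≤ e²`, i.e. `ActAbsBound … (A ≡ e²)`. -/
theorem toy_absBound : ActAbsBound oneIndexing toyData toyClass Set.univ fun _ _ _ _ _ => Real.exp 2 := by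
  intro k g _ U q hq X _ i _ m
  obtain ⟨ho, hh⟩ := mem_toyClass hq
  show ∫ _ : Unit, ‖Complex.exp q.1‖ * ‖Complex.exp (ContinuousLinearMap.id ℂ ℂ q.2)‖ ∂(Measure.dirac ()) ≤ Real.exp 2
  rw [integral_dirac, ContinuousLinearMap.id_apply, Complex.norm_exp, Complex.norm_exp, ← Real.exp_add]
  refine Real.exp_le_exp.2 ?_
  linarith [(Complex.re_le_norm q.1).trans ho, (Complex.re_le_norm q.2).trans hh]

/-- [folklore] The induced combinatorial majorant is the constant `e²` at step-`k` domains. -/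
theorem toy_actMajorant {k : ℕ} {X : toyCarriers.Dom} (hX : toyCarriers.scale X = k) (i : Unit) :
    actMajorant oneIndexing topInc (fun _ _ => Real.exp 2) k X i = Real.exp 2 := by
  rw [actMajorant_of_rel (show oneIndexing.Rel k i X from hX), coeff_one, norm_one, one_mul]
  exact Fin.prod_univ_one _

/-- [folklore] The induced secant majorant is the constant `e²` (one factor, `N = 1`). -/
theorem toy_secMajorant {k : ℕ} {X : toyCarriers.Dom} (hX : toyCarriers.scale X = k) (i : Unit) :
    secMajorant oneIndexing topInc (fun _ _ => (1 : ℝ)) (fun _ _ => Real.exp 2) k X i = Real.exp 2 := by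
  rw [secMajorant, toy_actMajorant hX]
  show (∑ _m : Fin (0 + 1), (1 : ℝ)) * Real.exp 2 = Real.exp 2
  simp

/-- [folklore] **THE PRODUCER FIRES ON THE TOY**: every binder of `histSecant_b13_of_act` holds (structure, `N ≡ 1`, `A ≡ e²`,
summability over the one-point index, first-moment budget `G₁ = e²` at `κ = 0`), giving `HistSecant toyModel toyClass univ 0 (2e²)`. -/
theorem toy_histSecant : HistSecant toyModel toyClass Set.univ 0 (2 * Real.exp 2) :=
  histSecant_b13_of_act (M := toyModel) (fun _ _ _ _ => rfl) toy_actExpLinearOn toy_normBound toy_absBound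
    (fun _ _ _ _ _ => zero_le_one) (fun _ _ _ _ _ _ => Summable.of_finite) fun k g _ U X hX =>
      ⟨Summable.of_finite, by
        rw [tsum_fintype, Fintype.sum_unique, toy_secMajorant hX, zero_mul, neg_zero, Real.exp_zero, mul_one]⟩

/-- [folklore] **READING THE CONCLUSION** (non-triviality): for `‖o‖, ‖h‖, ‖h′‖ ≤ 1`, `‖e^{o+h′} − e^{o+h}‖ ≤ 2e²·‖h′ − h‖`. -/
theorem toy_reading {o h h' : ℂ} (ho : ‖o‖ ≤ 1) (hh : ‖h‖ ≤ 1) (hh' : ‖h'‖ ≤ 1) :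
    ‖Complex.exp (o + h') - Complex.exp (o + h)‖ ≤ 2 * Real.exp 2 * ‖h' - h‖ := by
  have hq : ((o, h) : ℂ × ℂ) ∈ toyClass 0 (fun _ => 0) () :=
    Set.mk_mem_prod (mem_closedBall_zero_iff.2 ho) (mem_closedBall_zero_iff.2 hh)
  have hq' : ((o, h') : ℂ × ℂ) ∈ toyClass 0 (fun _ => 0) () :=
    Set.mk_mem_prod (mem_closedBall_zero_iff.2 ho) (mem_closedBall_zero_iff.2 hh')
  have key := toy_histSecant 0 (fun _ => 0) (Set.mem_univ _) () o h h' hq hq' (0 : ℕ) rfl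
  rw [out_eq (k := 0) (X := (0 : ℕ)) rfl, out_eq (k := 0) (X := (0 : ℕ)) rfl] at key
  have hr : toyModel.rHist 0 = 1 := rfl
  have hd : toyCarriers.d (0 : ℕ) = 0 := rfl
  rw [hr, hd, div_one, mul_zero, neg_zero, Real.exp_zero, mul_one] at key
  exact key

end Summit.QuantumFields.BalabanUV.T4Continuum.B13TermHistSecantWitness

end
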